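import Mathlib

/-!
# `BalabanUV.Beta.GAN24.CrossedLedgerPotentialNormalForm` — binder row G-an2-4 ∕ (CONV-C), W-slot (α-0), ROW (C)sym AT LEVELS `≥ 1`, register PART VI row **T6-VAL**:
# **THE POTENTIAL FORM OF `CrossedLedgerClosure` IS A NORMAL FORM** — for `γ ≠ 0`, ANY crossed cell ∕ face values `Xc`, `Xf` admit a two-index potential `G` and a Wilson part `W`
# with `Xf (k+1) m = G (k+1) (m+1) − G (k+2) m`, `Xc (i+1) = γ·G (i+1) 0`, `Xf 0 m = W m − G 1 m` (companion of `CrossedLedgerClosure` ✓ p382567, §1's hypotheses)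
# (G-an2-4 CRUX TEAM (2), leaf prover 03 `b2b-balaban-gan24-formalise-leaf-03`, gen 72; journal [LEAF03-G72-INTENT1] A-3)

NOT IN PRINT; OUR BOOKKEEPING ([folklore] a recursion on the period index; `import Mathlib` only — lane-independent; 0 `def` (the potential is an anonymous `Nat.rec`), 0 cited
fact, 0 `def … : Prop`, 0 sorry).  HONEST FRAMING (cell contract, verbatim): «discharging `BetaPertH` makes Bałaban's UV stability UNCONDITIONAL — a real constructive-QFT
result; it is NOT the continuum limit and NOT the Clay problem.»  HONEST DEPENDENCY (verbatim): «continuum YM on T⁴ ⇐ BetaPertH ∧ nine spine estimates (0/9 proved); BetaPertH ⇐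
(D1) ∧ (D4) ∧ CAP+tail; G-an2-4 gates asym, D1 and NE2/3/4.»

WHY.  `CrossedLedgerClosure` §1–§2 (this lineage, ✓ p382567) close the crossed ledger of the OWNER's two-index tower GRANTED the «potential form» of the E-frame forcing's
crossed values — hypotheses `hface` ∕ `hcell` ∕ `hface0` over free letters `G : ℕ → ℕ → ℝ`, `W : ℕ → ℝ` (leaf-06 g55's depth-tower shapes are an instance, §3 there).  Its §0
and the journal (A-3 l.59303) say that the potential form is NOT an extra assumption: the content of row T6-VAL is the VALUE of the cumulative quantity, and the potential form
is only the (γ) hand's way to evaluate it.  THIS FILE makes that remark a theorem: for `γ ≠ 0` and ARBITRARY `Xc`, `Xf` there EXIST `G`, `W` satisfying the three shapes —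
`G` is built upward in the period index (`G k 0 := Xc k ∕ γ`, `G k (n+1) := Xf k n + G (k+1) n`), `W m := Xf 0 m + G 1 m`.  So every consequence of `CrossedLedgerClosure` that
quantifies over SOME potential form is unconditional; what carries weight is an EXPLICIT `G` (the depth tower's Green's-function pairings) and the explicit `W` (the level-`0`
Wilson part), i.e. the (γ) hand's letters K7-a ∕ K7-b ∕ K7-0.

WHAT ([folklore]; letters `Xf : ℕ → ℕ → ℝ` (level, period index), `Xc : ℕ → ℝ`, `γ : ℝ`):
* **`potential_exists`** (`γ ≠ 0`): `∃ G W, (∀ k m, Xf (k+1) m = G (k+1) (m+1) − G (k+2) m) ∧ (∀ i, Xc (i+1) = γ·G (i+1) 0) ∧ (∀ m, Xf 0 m = W m − G 1 m)`;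
* **`potential_exists'`** (any `γ`, cell shape stated as `∃ G` with `γ·G (i+1) 0` replaced by a free foot `F (i+1)`): the face shapes alone are ALWAYS solvable —
  `∃ G W, (∀ k m, Xf (k+1) m = G (k+1) (m+1) − G (k+2) m) ∧ (∀ i, G (i+1) 0 = F (i+1)) ∧ (∀ m, Xf 0 m = W m − G 1 m)` for any prescribed foot `F : ℕ → ℝ`.
Asserts NOTHING about Bałaban's tables; discharges NOTHING of `hX` ∕ `hXu` ∕ (C)_{≥1} ∕ `hB0` ∕ `hBF` ∕ (Q-L); NEVER «G-an2-4 closed» as (CONV-C); NOT D1, NOT `BetaPertH`, NOT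
continuum, NOT Clay.  2026-08-24; no existing file touched.
-/

namespace Summit.QuantumFields.BalabanUV.Beta.GAN24.CrossedLedgerPotentialNormalForm

variable {Xf : ℕ → ℕ → ℝ} {Xc F : ℕ → ℝ} {γ : ℝ}

/-- NOT IN PRINT; OUR BOOKKEEPING.  **THE FACE SHAPES ARE ALWAYS SOLVABLE WITH A PRESCRIBED FOOT** (any `Xf`, any foot `F`): there are `G : ℕ → ℕ → ℝ` and `W : ℕ → ℝ` with
`G (i+1) 0 = F (i+1)`, `Xf (k+1) m = G (k+1) (m+1) − G (k+2) m` and `Xf 0 m = W m − G 1 m` — `G` built upward in the period index by `G k (n+1) := Xf k n + G (k+1) n` from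
`G k 0 := F k`, then `W m := Xf 0 m + G 1 m`. -/
theorem potential_exists' (Xf : ℕ → ℕ → ℝ) (F : ℕ → ℝ) :
    ∃ (G : ℕ → ℕ → ℝ) (W : ℕ → ℝ),
      (∀ k m, Xf (k + 1) m = G (k + 1) (m + 1) - G (k + 2) m) ∧ (∀ i, G (i + 1) 0 = F (i + 1)) ∧ (∀ m, Xf 0 m = W m - G 1 m) := by
  -- `g n` = the period-index-`n` column of the potential, as a function of the level
  let g : ℕ → ℕ → ℝ := fun n => Nat.rec (motive := fun _ => ℕ → ℝ) F (fun n col k => Xf k n + col (k + 1)) n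
  refine ⟨fun k n => g n k, fun m => Xf 0 m + g m 1, fun k m => ?_, fun i => rfl, fun m => by ring⟩
  show Xf (k + 1) m = (Xf (k + 1) m + g m (k + 1 + 1)) - g m (k + 2)
  ring

/-- NOT IN PRINT; OUR BOOKKEEPING.  **THE POTENTIAL FORM IS A NORMAL FORM** (`γ ≠ 0`; any crossed cell values `Xc`, any crossed face values `Xf`): there EXIST `G`, `W` with the
three shapes of `CrossedLedgerClosure` §1 — `hface : Xf (k+1) m = G (k+1) (m+1) − G (k+2) m`, `hcell : Xc (i+1) = γ·G (i+1) 0`, `hface0 : Xf 0 m = W m − G 1 m`.  Hence every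
statement of `CrossedLedgerClosure` ∕ `CrossedLedgerForcingWilson` that asks for SOME potential form asks nothing; the weight lies in an EXPLICIT `G` and `W`. -/
theorem potential_exists (hγ : γ ≠ 0) (Xc : ℕ → ℝ) (Xf : ℕ → ℕ → ℝ) :
    ∃ (G : ℕ → ℕ → ℝ) (W : ℕ → ℝ),
      (∀ k m, Xf (k + 1) m = G (k + 1) (m + 1) - G (k + 2) m) ∧ (∀ i, Xc (i + 1) = γ * G (i + 1) 0) ∧ (∀ m, Xf 0 m = W m - G 1 m) := by
  obtain ⟨G, W, hface, hfoot, hface0⟩ := potential_exists' Xf (fun i => Xc i / γ)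
  refine ⟨G, W, hface, fun i => ?_, hface0⟩
  rw [hfoot]
  field_simp

end Summit.QuantumFields.BalabanUV.Beta.GAN24.CrossedLedgerPotentialNormalForm
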